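/-
Copyright (c) 2026 the pub-hodgecm-mathlib formalisation cell (harness21).  Prover seat hodgecm-mathlib-K2E3-p12 (g3), Track B «K2-LIT» ∕ h413
(`stmt-HodgeConjecture-24833`), line `K2_E3_EllipticInputs`, unit U12-d, §L: THE REGULAR NILPOTENT ORBITAL MEASURE OF `𝔤𝔩₂(F)` AS A MEASURE — the
push-forward `ν = chart_* (κ ⊗ dx)` of the `K × F` chart is a `GL₂(F)`-INVARIANT Borel measure on `𝔤𝔩₂(F)`, finite on compact sets, carried by `𝒩 ∖ {0}`.
2026-09-04.
-/
import Summits.HodgeConjecture.HodgeConjecture.Theorems.K2E3GL2RegularNilpotentOrbitalMeasure   -- ★ p856734 (this seat): `continuous_conjNilp`, `nilpotentAverage_conj`, …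
import Literature.NumberTheory.GaloisRepresentations.LocalReciprocityThetaProofs              -- ★ `totallyDisconnectedSpace_of_isNonarchimedeanLocalField`
import Mathlib.Topology.Separation.Profinite
import Mathlib.LinearAlgebra.Matrix.Charpoly.Coeff
import HarnessLib

/-!
# K2_E3 road (h413), §L — `ν := chart_*(κ ⊗ dx)`, the regular nilpotent orbital measure of `𝔤𝔩₂(F)` as an invariant Borel measure

Cell `pub/hodgecm-mathlib` (D-0151), Track B, seat K2E3-p12 (g3), §L line lead (dealer K2E3-plan (g2), D20); self-deal S2a announced on the squad bus
2026-09-04T02:4xZ.  `--supports stmt-HodgeConjecture-24833 --as helper`; THEOREMS ONLY (no definition ∕ instance ∕ notation ∕ named fact ∕ `sorry`); never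
imports `Cruxes/…/Lines`.  COUNT-NEUTRAL.

Purpose.  The structure leaf (LBGL-2a′) «`T = c·μ_reg` on test functions vanishing near `0`» of (L-B_GL) at `N = 2` (★ p856851, ★ p856788) is the
uniqueness of invariant functionals on ONE orbit, ★ `Literature.MeasureTheory.Group.exists_forall_apply_eq_const_mul_integral_of_smul_invariant_of_additive`
(«COINV-1»), applied to the regular nilpotent orbit `𝒪_reg = 𝒩 ∖ {0}`; that theorem wants an honest INVARIANT MEASURE on the orbit.  This file manufactures it
on `𝔤𝔩₂(F)`: with `chart (k, t) = k (tE₁₂) k⁻¹` (★ p856734) and `ν := (κ ⊗ dx).map chart`,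
* §0 (general, totally disconnected locally compact second countable Hausdorff `X`) `isTopologicalBasis_isCompact_isOpen` and
  **`measure_ext_of_forall_isCompact_isOpen`** — two Borel measures, the first finite on compacts, agreeing on COMPACT OPEN sets are equal (Dynkin on the
  π-system of compact open sets, Mathlib `ext_of_generateFrom_of_cover_subset`) [BernsteinZelevinsky1976, §1.1–§1.3];
* §1 `isNilpotent_iff_mul_self_eq_zero` (2 × 2), `isClosed_setOf_isNilpotent`, `conjNilp_eq_zero_iff` (`k (tE₁₂) k⁻¹ = 0 ↔ t = 0`);
* §2 **`isFiniteMeasureOnCompacts_map_conjNilp`** (the `t`-coordinate is bounded on `chart⁻¹` of a compact set), `map_conjNilp_apply_singleton_zero`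
  (`ν{0} = 0`), `map_conjNilp_apply_compl_setOf_isNilpotent` (`ν(𝒩ᶜ) = 0`), `integral_map_conjNilp` (`∫ f dν = μ_reg(f)`);
* §3 **`map_conj_map_conjNilp`** — `ν.map (Ad g) = ν` for every `g ∈ GL₂(F)`: by §0 it suffices to test compact open `S`, where it is ★ `nilpotentAverage_conj`
  for the test function `1_S`.
[HarishChandra1999AdmissibleDistributions, §3 pp. 8–10 (Deligne–Rao invariant measure on a nilpotent orbit)].

References: [HarishChandra1999AdmissibleDistributions] Harish-Chandra (DeBacker–Sally), AMS ULECT 16 (1999), §3 pp. 8–10 · [BernsteinZelevinsky1976] Russian Math.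
Surveys 31:3 (1976), §1.1–§1.3, §1.18.
-/

set_option autoImplicit false
set_option linter.dupNamespace false   -- `Summit.HodgeConjecture.HodgeConjecture.…` (D-0017 nested layout; lakefile exemption for Summits)

noncomputable section

open MeasureTheory Measure Filter Topology TopologicalSpace
open scoped MatrixGroups NNReal ENNReal
open Literature.NumberTheory.Rogawski1990 Literature.NumberTheory.Automorphic Literature.NumberTheory.Automorphic.LocalFieldHaar
open Literature.NumberTheory.GaloisRepresentations Literature.NumberTheory.GaloisRepresentations.IsNonarchimedeanLocalField
open Summit.HodgeConjecture.HodgeConjecture.Cruxes.H413.K2E3GL2RegularNilpotentOrbitalMeasure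

namespace Summit.HodgeConjecture.HodgeConjecture.Cruxes.H413.K2E3GL2RegularNilpotentOrbitPushforward

/-! ## §0  Borel measures on a totally disconnected space are determined on compact open sets -/

section TD

variable {X : Type*} [TopologicalSpace X] [LocallyCompactSpace X] [T2Space X] [TotallyDisconnectedSpace X]

/-- In a totally disconnected locally compact Hausdorff space the COMPACT OPEN sets form a basis of the topology (clopen basis, Mathlib
`loc_compact_Haus_tot_disc_of_zero_dim`, cut down inside a compact neighbourhood). [cite: BernsteinZelevinsky1976, §1.1] -/
theorem isTopologicalBasis_isCompact_isOpen : IsTopologicalBasis {S : Set X | IsCompact S ∧ IsOpen S} := by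
  refine isTopologicalBasis_of_isOpen_of_nhds (fun S hS => hS.2) fun x U hxU hU => ?_
  obtain ⟨K, hKc, hKx⟩ := exists_compact_mem_nhds x
  have hxV : x ∈ interior K ∩ U := ⟨mem_interior_iff_mem_nhds.2 hKx, hxU⟩
  obtain ⟨W, hWclopen, hxW, hWV⟩ :=
    (loc_compact_Haus_tot_disc_of_zero_dim (H := X)).exists_subset_of_mem_open hxV (isOpen_interior.inter hU)
  exact ⟨W, ⟨hKc.of_isClosed_subset hWclopen.1 (hWV.trans (Set.inter_subset_left.trans interior_subset)), hWclopen.2⟩, hxW,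
    hWV.trans Set.inter_subset_right⟩

variable [SecondCountableTopology X] [MeasurableSpace X] [BorelSpace X]

/-- **Two Borel measures agreeing on compact open sets are equal** (the first finite on compacts; totally disconnected locally compact second countable
Hausdorff `X`): the compact open sets form a π-system and a basis, hence generate the Borel σ-algebra, and countably many of them cover `X`.
[cite: BernsteinZelevinsky1976, §1.3] -/
theorem measure_ext_of_forall_isCompact_isOpen {μ ν : Measure X} [IsFiniteMeasureOnCompacts μ]
    (h : ∀ S : Set X, IsCompact S → IsOpen S → μ S = ν S) : μ = ν := by
  have hB := isTopologicalBasis_isCompact_isOpen (X := X)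
  have hnhds : ∀ x : X, ∃ S : Set X, (IsCompact S ∧ IsOpen S) ∧ x ∈ S := fun x => by
    obtain ⟨S, hS, hxS, -⟩ := hB.exists_subset_of_mem_open (Set.mem_univ x) isOpen_univ
    exact ⟨S, hS, hxS⟩
  choose f hf hxf using hnhds
  obtain ⟨s, hsc, hsU⟩ := TopologicalSpace.countable_cover_nhds (f := f) fun x => (hf x).2.mem_nhds (hxf x)
  refine Measure.ext_of_generateFrom_of_cover_subset (S := {S : Set X | IsCompact S ∧ IsOpen S}) (T := f '' s)
    ((‹BorelSpace X›.measurable_eq).trans hB.borel_eq_generateFrom) ?_ ?_ (hsc.image f) ?_ ?_ fun S hS => h S hS.1 hS.2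
  · intro S hS T hT _
    exact ⟨hS.1.inter_right hT.1.isClosed, hS.2.inter hT.2⟩
  · rintro _ ⟨x, -, rfl⟩
    exact hf x
  · rw [Set.sUnion_image]; exact hsU
  · rintro _ ⟨x, -, rfl⟩
    exact (hf x).1.measure_lt_top.ne

end TD

/-! ## §1  The nilpotent cone of `𝔤𝔩₂(F)` -/

section Cone

variable {F : Type*} [Field F]

/-- A `2 × 2` matrix is nilpotent iff it squares to zero (Cayley–Hamilton: its characteristic polynomial is `X²`).
[cite: HarishChandra1999AdmissibleDistributions, §3 p. 8] -/
theorem isNilpotent_iff_mul_self_eq_zero (N : Matrix (Fin 2) (Fin 2) F) : IsNilpotent N ↔ N * N = 0 := by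
  refine ⟨fun hN => ?_, fun h => ⟨2, by rw [pow_two, h]⟩⟩
  have h1 : N.charpoly = Polynomial.X ^ 2 := by
    have h := (Matrix.isNilpotent_charpoly_sub_pow_of_isNilpotent hN).eq_zero
    rw [sub_eq_zero] at h
    simpa using h
  have h2 := Matrix.aeval_self_charpoly N
  rwa [h1, map_pow, Polynomial.aeval_X, pow_two] at h2

/-- The nilpotent cone `𝒩 ⊂ 𝔤𝔩₂(F)` is closed (`= {N | N·N = 0}`). [cite: HarishChandra1999AdmissibleDistributions, §3 p. 8] -/
theorem isClosed_setOf_isNilpotent [TopologicalSpace F] [IsTopologicalRing F] [T2Space F] :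
    IsClosed {N : Matrix (Fin 2) (Fin 2) F | IsNilpotent N} := by
  have h : {N : Matrix (Fin 2) (Fin 2) F | IsNilpotent N} = (fun N : Matrix (Fin 2) (Fin 2) F => N * N) ⁻¹' {0} := by
    ext N; simp only [Set.mem_setOf_eq, Set.mem_preimage, Set.mem_singleton_iff, isNilpotent_iff_mul_self_eq_zero]
  rw [h]
  exact isClosed_singleton.preimage (continuous_id.matrix_mul continuous_id)

/-- `k (tE₁₂) k⁻¹ = 0 ↔ t = 0`. [folklore] -/
theorem conjNilp_eq_zero_iff (k : GL (Fin 2) F) (t : F) :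
    (k : Matrix (Fin 2) (Fin 2) F) * !![0, t; 0, 0] * ((k⁻¹ : GL (Fin 2) F) : Matrix (Fin 2) (Fin 2) F) = 0 ↔ t = 0 := by
  constructor
  · intro h
    have h' := nilp_eq_inv_conj_conj k t
    rw [h, Matrix.mul_zero, Matrix.zero_mul] at h'
    have := congr_fun (congr_fun h' 0) 1
    simpa using this
  · rintro rfl
    have : (!![0, (0 : F); 0, 0] : Matrix (Fin 2) (Fin 2) F) = 0 := by
      ext i j; fin_cases i <;> fin_cases j <;> rfl
    rw [this, Matrix.mul_zero, Matrix.zero_mul]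

end Cone

/-! ## §2  `ν = chart_*(κ ⊗ dx)`: finiteness on compacts, null sets, integrals -/

section Pushforward

variable {F : Type*} [Field F] [ValuativeRel F] [TopologicalSpace F] [IsNonarchimedeanLocalField F]
  [MeasurableSpace F] [BorelSpace F] [MeasurableSpace (GL (Fin 2) F)] [BorelSpace (GL (Fin 2) F)]
  [MeasurableSpace (Matrix (Fin 2) (Fin 2) F)] [BorelSpace (Matrix (Fin 2) (Fin 2) F)]
  (κ : Measure ↥(glInt 2 F)) (dx : Measure F)

/-- The chart `(k, t) ↦ k (tE₁₂) k⁻¹ : GL₂(𝒪) × F → 𝔤𝔩₂(F)` is measurable. [folklore] -/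
theorem measurable_conjNilp :
    Measurable fun p : ↥(glInt 2 F) × F =>
      ((p.1 : GL (Fin 2) F) : Matrix (Fin 2) (Fin 2) F) * !![0, p.2; 0, 0] * ((((p.1 : GL (Fin 2) F))⁻¹ : GL (Fin 2) F) : Matrix (Fin 2) (Fin 2) F) := by
  haveI : T2Space F := (isLocalField F).toT2Space
  haveI : SecondCountableTopology F := secondCountableTopology_localField F
  haveI : BorelSpace ↥(glInt 2 F) := Subtype.borelSpace _
  exact (continuous_conjNilp (F := F)).measurable

/-- **`ν = chart_*(κ ⊗ dx)` is finite on compact sets**: on `chart⁻¹(C)`, `C` compact, the coordinate `t = (k⁻¹ X k)₀₁` stays in a compact set.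
[cite: HarishChandra1999AdmissibleDistributions, §3 p. 9] -/
theorem isFiniteMeasureOnCompacts_map_conjNilp [IsFiniteMeasureOnCompacts κ] [IsFiniteMeasureOnCompacts dx] :
    IsFiniteMeasureOnCompacts ((κ.prod dx).map fun p : ↥(glInt 2 F) × F =>
      ((p.1 : GL (Fin 2) F) : Matrix (Fin 2) (Fin 2) F) * !![0, p.2; 0, 0] * ((((p.1 : GL (Fin 2) F))⁻¹ : GL (Fin 2) F) : Matrix (Fin 2) (Fin 2) F)) := by
  haveI : CompactSpace ↥(glInt 2 F) := isCompact_iff_compactSpace.1 (isCompact_glInt 2 F)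
  haveI : T2Space F := (isLocalField F).toT2Space
  refine ⟨fun C hC => ?_⟩
  rw [Measure.map_apply (measurable_conjNilp (F := F)) hC.measurableSet]
  -- `t` is read off the conjugate: `t = (k⁻¹ (k tE k⁻¹) k)₀₁`
  set T : Set F := (fun q : ↥(glInt 2 F) × Matrix (Fin 2) (Fin 2) F =>
      (((((q.1 : GL (Fin 2) F))⁻¹ : GL (Fin 2) F) : Matrix (Fin 2) (Fin 2) F) * q.2 * ((q.1 : GL (Fin 2) F) : Matrix (Fin 2) (Fin 2) F)) 0 1) ''
    (Set.univ ×ˢ C) with hT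
  have hTc : IsCompact T := by
    refine (isCompact_univ.prod hC).image ?_
    have h1 : Continuous fun q : ↥(glInt 2 F) × Matrix (Fin 2) (Fin 2) F => ((((q.1 : GL (Fin 2) F))⁻¹ : GL (Fin 2) F) : Matrix (Fin 2) (Fin 2) F) :=
      Units.continuous_coe_inv.comp (continuous_subtype_val.comp continuous_fst)
    have h3 : Continuous fun q : ↥(glInt 2 F) × Matrix (Fin 2) (Fin 2) F => ((q.1 : GL (Fin 2) F) : Matrix (Fin 2) (Fin 2) F) :=
      Units.continuous_val.comp (continuous_subtype_val.comp continuous_fst)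
    exact ((h1.mul continuous_snd).mul h3).matrix_elem 0 1
  have hsub : (fun p : ↥(glInt 2 F) × F =>
      ((p.1 : GL (Fin 2) F) : Matrix (Fin 2) (Fin 2) F) * !![0, p.2; 0, 0] * ((((p.1 : GL (Fin 2) F))⁻¹ : GL (Fin 2) F) : Matrix (Fin 2) (Fin 2) F)) ⁻¹' C ⊆
      Set.univ ×ˢ T := by
    intro p hp
    refine Set.mk_mem_prod (Set.mem_univ _) ⟨⟨p.1, _⟩, Set.mk_mem_prod (Set.mem_univ _) hp, ?_⟩
    show (((((p.1 : GL (Fin 2) F))⁻¹ : GL (Fin 2) F) : Matrix (Fin 2) (Fin 2) F) *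
        (((p.1 : GL (Fin 2) F) : Matrix (Fin 2) (Fin 2) F) * !![0, p.2; 0, 0] * ((((p.1 : GL (Fin 2) F))⁻¹ : GL (Fin 2) F) : Matrix (Fin 2) (Fin 2) F)) *
        ((p.1 : GL (Fin 2) F) : Matrix (Fin 2) (Fin 2) F)) 0 1 = p.2
    rw [← nilp_eq_inv_conj_conj]
    simp
  calc (κ.prod dx) _ ≤ (κ.prod dx) (Set.univ ×ˢ T) := measure_mono hsub
    _ ≤ κ Set.univ * dx T := Measure.prod_prod_le _ _
    _ < ∞ := ENNReal.mul_lt_top (IsCompact.measure_lt_top isCompact_univ) hTc.measure_lt_top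

/-- **`ν{0} = 0`**: `chart⁻¹{0} = GL₂(𝒪) × {0}` and the Haar measure of `F` has no atom at `0`. [cite: HarishChandra1999AdmissibleDistributions, §3 p. 9] -/
theorem map_conjNilp_apply_singleton_zero [SFinite κ] [dx.IsAddHaarMeasure] :
    ((κ.prod dx).map fun p : ↥(glInt 2 F) × F =>
      ((p.1 : GL (Fin 2) F) : Matrix (Fin 2) (Fin 2) F) * !![0, p.2; 0, 0] * ((((p.1 : GL (Fin 2) F))⁻¹ : GL (Fin 2) F) : Matrix (Fin 2) (Fin 2) F)) {0} = 0 := by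
  haveI : T2Space F := (isLocalField F).toT2Space
  haveI : SecondCountableTopology F := secondCountableTopology_localField F
  rw [Measure.map_apply (measurable_conjNilp (F := F)) (measurableSet_singleton 0)]
  have h : (fun p : ↥(glInt 2 F) × F =>
      ((p.1 : GL (Fin 2) F) : Matrix (Fin 2) (Fin 2) F) * !![0, p.2; 0, 0] * ((((p.1 : GL (Fin 2) F))⁻¹ : GL (Fin 2) F) : Matrix (Fin 2) (Fin 2) F)) ⁻¹' {0} =
      Set.univ ×ˢ ({0} : Set F) := by
    ext p
    simp only [Set.mem_preimage, Set.mem_singleton_iff, Set.mem_prod, Set.mem_univ, true_and, conjNilp_eq_zero_iff]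
  rw [h, Measure.prod_prod, measure_singleton_zero, mul_zero]

/-- **`ν` is carried by the nilpotent cone**: `ν(𝒩ᶜ) = 0` (every `k (tE₁₂) k⁻¹` is nilpotent). [cite: HarishChandra1999AdmissibleDistributions, §3 p. 9] -/
theorem map_conjNilp_apply_compl_setOf_isNilpotent :
    ((κ.prod dx).map fun p : ↥(glInt 2 F) × F =>
      ((p.1 : GL (Fin 2) F) : Matrix (Fin 2) (Fin 2) F) * !![0, p.2; 0, 0] * ((((p.1 : GL (Fin 2) F))⁻¹ : GL (Fin 2) F) : Matrix (Fin 2) (Fin 2) F))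
      {N : Matrix (Fin 2) (Fin 2) F | IsNilpotent N}ᶜ = 0 := by
  haveI : T2Space F := (isLocalField F).toT2Space
  rw [Measure.map_apply (measurable_conjNilp (F := F)) (isClosed_setOf_isNilpotent (F := F)).measurableSet.compl]
  have h : (fun p : ↥(glInt 2 F) × F =>
      ((p.1 : GL (Fin 2) F) : Matrix (Fin 2) (Fin 2) F) * !![0, p.2; 0, 0] * ((((p.1 : GL (Fin 2) F))⁻¹ : GL (Fin 2) F) : Matrix (Fin 2) (Fin 2) F)) ⁻¹'
      {N : Matrix (Fin 2) (Fin 2) F | IsNilpotent N}ᶜ = ∅ := by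
    ext p
    simp only [Set.mem_preimage, Set.mem_compl_iff, Set.mem_setOf_eq, Set.mem_empty_iff_false, iff_false, not_not]
    exact isNilpotent_conj_nilp (F := F) p.1 p.2
  rw [h, measure_empty]

/-- **`∫ f dν = μ_reg(f)`** — integrals against the push-forward are the `K × F` orbital integrals of ★ p856734.
[cite: HarishChandra1999AdmissibleDistributions, §3 p. 9] -/
theorem integral_map_conjNilp {E : Type*} [NormedAddCommGroup E] [NormedSpace ℝ E] {f : Matrix (Fin 2) (Fin 2) F → E}
    (hf : AEStronglyMeasurable f ((κ.prod dx).map fun p : ↥(glInt 2 F) × F =>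
      ((p.1 : GL (Fin 2) F) : Matrix (Fin 2) (Fin 2) F) * !![0, p.2; 0, 0] * ((((p.1 : GL (Fin 2) F))⁻¹ : GL (Fin 2) F) : Matrix (Fin 2) (Fin 2) F))) :
    ∫ X, f X ∂((κ.prod dx).map fun p : ↥(glInt 2 F) × F =>
      ((p.1 : GL (Fin 2) F) : Matrix (Fin 2) (Fin 2) F) * !![0, p.2; 0, 0] * ((((p.1 : GL (Fin 2) F))⁻¹ : GL (Fin 2) F) : Matrix (Fin 2) (Fin 2) F)) =
    ∫ p : ↥(glInt 2 F) × F, f (((p.1 : GL (Fin 2) F) : Matrix (Fin 2) (Fin 2) F) * !![0, p.2; 0, 0] *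
      ((((p.1 : GL (Fin 2) F))⁻¹ : GL (Fin 2) F) : Matrix (Fin 2) (Fin 2) F)) ∂(κ.prod dx) :=
  integral_map (measurable_conjNilp (F := F)).aemeasurable hf

end Pushforward

/-! ## §3  `ν` is `Ad(GL₂(F))`-invariant -/

section Invariance

variable {F : Type*} [Field F] [ValuativeRel F] [TopologicalSpace F] [IsNonarchimedeanLocalField F]
  [SecondCountableTopology F] [MeasurableSpace F] [BorelSpace F]
  [MeasurableSpace (GL (Fin 2) F)] [BorelSpace (GL (Fin 2) F)] [SecondCountableTopology (GL (Fin 2) F)]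
  [MeasurableSpace (Matrix (Fin 2) (Fin 2) F)] [BorelSpace (Matrix (Fin 2) (Fin 2) F)]
  (κ : Measure ↥(glInt 2 F)) [IsHaarMeasure κ] (dx : Measure F) [dx.IsAddHaarMeasure]

omit [ValuativeRel F] [IsNonarchimedeanLocalField F] [SecondCountableTopology F] [MeasurableSpace F] [BorelSpace F]
  [MeasurableSpace (GL (Fin 2) F)] [BorelSpace (GL (Fin 2) F)] [SecondCountableTopology (GL (Fin 2) F)]
  [MeasurableSpace (Matrix (Fin 2) (Fin 2) F)] [BorelSpace (Matrix (Fin 2) (Fin 2) F)] in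
/-- `X ↦ g X g⁻¹` is continuous. [folklore] -/
theorem continuous_conj [IsTopologicalRing F] (g : GL (Fin 2) F) :
    Continuous fun X : Matrix (Fin 2) (Fin 2) F => (g : Matrix (Fin 2) (Fin 2) F) * X * ((g⁻¹ : GL (Fin 2) F) : Matrix (Fin 2) (Fin 2) F) :=
  (continuous_const.matrix_mul continuous_id).matrix_mul continuous_const

set_option maxHeartbeats 800000 in
/-- **`Ad(g)_* ν = ν` for every `g ∈ GL₂(F)`**: by §0 it suffices to compare the two measures on a compact open `S`, where the identity is ★
`nilpotentAverage_conj` for the test function `1_S ∈ C_c^∞(𝔤𝔩₂(F))`.  (`ν` is the Deligne–Rao invariant measure of the regular nilpotent orbit, in the `K × F`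
chart.) [cite: HarishChandra1999AdmissibleDistributions, §3 pp. 8–10] -/
theorem map_conj_map_conjNilp (g : GL (Fin 2) F) :
    ((κ.prod dx).map fun p : ↥(glInt 2 F) × F =>
        ((p.1 : GL (Fin 2) F) : Matrix (Fin 2) (Fin 2) F) * !![0, p.2; 0, 0] * ((((p.1 : GL (Fin 2) F))⁻¹ : GL (Fin 2) F) : Matrix (Fin 2) (Fin 2) F)).map
      (fun X : Matrix (Fin 2) (Fin 2) F => (g : Matrix (Fin 2) (Fin 2) F) * X * ((g⁻¹ : GL (Fin 2) F) : Matrix (Fin 2) (Fin 2) F)) =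
    (κ.prod dx).map fun p : ↥(glInt 2 F) × F =>
        ((p.1 : GL (Fin 2) F) : Matrix (Fin 2) (Fin 2) F) * !![0, p.2; 0, 0] * ((((p.1 : GL (Fin 2) F))⁻¹ : GL (Fin 2) F) : Matrix (Fin 2) (Fin 2) F) := by
  classical
  haveI : T2Space F := (isLocalField F).toT2Space
  haveI : LocallyCompactSpace F := (isLocalField F).toLocallyCompactSpace
  haveI : LocallyCompactSpace (Matrix (Fin 2) (Fin 2) F) := Pi.locallyCompactSpace_of_finite
  haveI : SecondCountableTopology (Matrix (Fin 2) (Fin 2) F) := inferInstanceAs (SecondCountableTopology (Fin 2 → Fin 2 → F))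
  haveI : TotallyDisconnectedSpace F := totallyDisconnectedSpace_of_isNonarchimedeanLocalField F
  haveI : TotallyDisconnectedSpace (Matrix (Fin 2) (Fin 2) F) := inferInstanceAs (TotallyDisconnectedSpace (Fin 2 → Fin 2 → F))
  haveI : CompactSpace ↥(glInt 2 F) := isCompact_iff_compactSpace.1 (isCompact_glInt 2 F)
  haveI := isFiniteMeasureOnCompacts_map_conjNilp (F := F) κ dx
  set chart : ↥(glInt 2 F) × F → Matrix (Fin 2) (Fin 2) F := fun p =>
    ((p.1 : GL (Fin 2) F) : Matrix (Fin 2) (Fin 2) F) * !![0, p.2; 0, 0] * ((((p.1 : GL (Fin 2) F))⁻¹ : GL (Fin 2) F) : Matrix (Fin 2) (Fin 2) F) with hchart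
  have hmeas : Measurable chart := measurable_conjNilp (F := F)
  have hAd : Measurable fun X : Matrix (Fin 2) (Fin 2) F => (g : Matrix (Fin 2) (Fin 2) F) * X * ((g⁻¹ : GL (Fin 2) F) : Matrix (Fin 2) (Fin 2) F) :=
    (continuous_conj g).measurable
  symm
  refine measure_ext_of_forall_isCompact_isOpen fun S hSc hSo => ?_
  rw [Measure.map_apply hAd hSo.measurableSet, Measure.map_apply hmeas hSo.measurableSet, Measure.map_apply hmeas (hAd hSo.measurableSet)]
  -- both preimages have finite measure
  have hS' : IsCompact ((fun X : Matrix (Fin 2) (Fin 2) F => (g : Matrix (Fin 2) (Fin 2) F) * X * ((g⁻¹ : GL (Fin 2) F) : Matrix (Fin 2) (Fin 2) F)) ⁻¹' S) := by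
    have heq : (fun X : Matrix (Fin 2) (Fin 2) F => (g : Matrix (Fin 2) (Fin 2) F) * X * ((g⁻¹ : GL (Fin 2) F) : Matrix (Fin 2) (Fin 2) F)) ⁻¹' S =
        (fun X : Matrix (Fin 2) (Fin 2) F => ((g⁻¹ : GL (Fin 2) F) : Matrix (Fin 2) (Fin 2) F) * X * (g : Matrix (Fin 2) (Fin 2) F)) '' S := by
      have hgg : ((g⁻¹ : GL (Fin 2) F) : Matrix (Fin 2) (Fin 2) F) * (g : Matrix (Fin 2) (Fin 2) F) = 1 := by
        rw [← Units.val_mul, inv_mul_cancel, Units.val_one]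
      have hgg' : (g : Matrix (Fin 2) (Fin 2) F) * ((g⁻¹ : GL (Fin 2) F) : Matrix (Fin 2) (Fin 2) F) = 1 := by
        rw [← Units.val_mul, mul_inv_cancel, Units.val_one]
      ext X
      simp only [Set.mem_preimage, Set.mem_image]
      constructor
      · intro hX
        refine ⟨_, hX, ?_⟩
        simp only [Matrix.mul_assoc, hgg, Matrix.mul_one]
        rw [← Matrix.mul_assoc, hgg, Matrix.one_mul]
      · rintro ⟨Y, hY, rfl⟩
        simp only [Matrix.mul_assoc, hgg', Matrix.mul_one]
        rwa [← Matrix.mul_assoc, hgg', Matrix.one_mul]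
    rw [heq]
    have hc := continuous_conj (F := F) g⁻¹
    simp only [inv_inv] at hc
    exact hSc.image hc
  have hfin₁ : (κ.prod dx) (chart ⁻¹' S) ≠ ∞ := by
    have := IsCompact.measure_lt_top (μ := (κ.prod dx).map chart) hSc
    rw [Measure.map_apply hmeas hSo.measurableSet] at this
    exact this.ne
  have hfin₂ : (κ.prod dx) (chart ⁻¹' ((fun X : Matrix (Fin 2) (Fin 2) F =>
      (g : Matrix (Fin 2) (Fin 2) F) * X * ((g⁻¹ : GL (Fin 2) F) : Matrix (Fin 2) (Fin 2) F)) ⁻¹' S)) ≠ ∞ := by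
    have := IsCompact.measure_lt_top (μ := (κ.prod dx).map chart) hS'
    rw [Measure.map_apply hmeas (hAd hSo.measurableSet)] at this
    exact this.ne
  -- ★ `nilpotentAverage_conj` for `f = 1_S`
  have key := nilpotentAverage_conj κ dx (isLocSmooth_indicator hSo hSc.isClosed hSc) g
  have hL : ∫ p : ↥(glInt 2 F) × F, S.indicator (fun _ => (1 : ℂ)) ((g : Matrix (Fin 2) (Fin 2) F) * chart p * ((g⁻¹ : GL (Fin 2) F) : Matrix (Fin 2) (Fin 2) F))
      ∂(κ.prod dx) = (((κ.prod dx).real (chart ⁻¹' ((fun X : Matrix (Fin 2) (Fin 2) F =>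
        (g : Matrix (Fin 2) (Fin 2) F) * X * ((g⁻¹ : GL (Fin 2) F) : Matrix (Fin 2) (Fin 2) F)) ⁻¹' S))) : ℂ) := by
    have h1 : (fun p : ↥(glInt 2 F) × F => S.indicator (fun _ => (1 : ℂ)) ((g : Matrix (Fin 2) (Fin 2) F) * chart p * ((g⁻¹ : GL (Fin 2) F) : Matrix (Fin 2) (Fin 2) F))) =
        (chart ⁻¹' ((fun X : Matrix (Fin 2) (Fin 2) F => (g : Matrix (Fin 2) (Fin 2) F) * X * ((g⁻¹ : GL (Fin 2) F) : Matrix (Fin 2) (Fin 2) F)) ⁻¹' S)).indicator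
          fun _ => (1 : ℂ) := by
      funext p
      simp only [Set.indicator, Set.mem_preimage]
    rw [h1, integral_indicator_const _ (hmeas (hAd hSo.measurableSet)), Complex.real_smul, mul_one]
  have hR : ∫ p : ↥(glInt 2 F) × F, S.indicator (fun _ => (1 : ℂ)) (chart p) ∂(κ.prod dx) = (((κ.prod dx).real (chart ⁻¹' S)) : ℂ) := by
    have h1 : (fun p : ↥(glInt 2 F) × F => S.indicator (fun _ => (1 : ℂ)) (chart p)) = (chart ⁻¹' S).indicator fun _ => (1 : ℂ) := by
      funext p
      simp only [Set.indicator, Set.mem_preimage]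
    rw [h1, integral_indicator_const _ (hmeas hSo.measurableSet), Complex.real_smul, mul_one]
  have key' : ((κ.prod dx).real (chart ⁻¹' ((fun X : Matrix (Fin 2) (Fin 2) F =>
        (g : Matrix (Fin 2) (Fin 2) F) * X * ((g⁻¹ : GL (Fin 2) F) : Matrix (Fin 2) (Fin 2) F)) ⁻¹' S))) =
      (κ.prod dx).real (chart ⁻¹' S) := by
    have h := key
    rw [hL, hR] at h
    exact_mod_cast h
  rw [measureReal_def, measureReal_def, ENNReal.toReal_eq_toReal_iff' hfin₂ hfin₁] at key'
  exact key'.symm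

end Invariance

end Summit.HodgeConjecture.HodgeConjecture.Cruxes.H413.K2E3GL2RegularNilpotentOrbitPushforward
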